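import Summits.Schanuel.Schanuel.Theses.DiophantineDichotomy
import Literature.NumberTheory.Transcendental.NesterenkoElimination
import HarnessLib

/-!
# Vocabulary of line `orbit-interpolation-determinant` for crux `ApproximationProperty` (stmt-Schanuel-6117)

Route `DiophantineDichotomy` (sub-problem `Schanuel/Schanuel`), crux
`Summit.Schanuel.Schanuel.Theses.DiophantineDichotomy.ApproximationProperty` (Philippon's approximation
property in transcendence degree `t`, pointwise affine form in the `(d, log H)` currency). This file is
the **definitions module** of the checked skeleton
`Cruxes/ApproximationProperty/Lines/orbit-interpolation-determinant.lean` (planner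
`planner-cruxplan-stmt-Schanuel-6117-orbit-interpolation--0`, reshaped and registered by the line lead
`prover-line-stmt-Schanuel-6117-0`, 7 registered stubs): it carries, verbatim and sorry-free, the
skeleton's VOCABULARY — the crux factored pointwise (`APDatum`, `APWith`, `APAt`, `PointwiseAP`,
`PointwiseAPSlice`) and the intermediate statements of the line (`CycleAPIAt`/`CycleAPI`: 0-cycle
approximation property with interpolation control, in Nesterenko's elimination language;
`OrbitClusterBound`: the lever; `ZeroDimDictionary`: structure of a rank-1 homogeneous prime;
`SharpClosestPoint`: the transfer `C⁺`; `PointAPAbsAt`/`PointAPAbs`: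
the point property in the Weil currency) — so that the stub files
`Theorems/DiophantineDichotomyApproximationProperty<StubName>.lean` (each proving a registered stub BY
NAME, `--supports stmt-Schanuel-6117`) and the closing skeleton share ONE copy of every object (same
design as `DiophantineDichotomyDefs.lean` for the sibling crux `KhovanskiiApproxType`). Nothing in this
file is asserted: every `def … : Prop` is a statement to be proved by a registered stub or a predicate;
the two `theorem`s are `Iff.rfl`-level reassemblies (`pointwiseAP_iff`, `pointwiseAP_iff_slice`).

Sources: NesterenkoPhilippon2001 (LNM 1752) Ch. 3 §4, Ch. 4 §4 p. 61 (AP1/AP2); LaurentRoy1999;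
Philippon2000 (doi:10.1006/jnth.1999.2461); ChardinPhilippon1999 (J. Algebraic Geom. 8).
-/

noncomputable section

-- `Summit.Schanuel.Schanuel.…` is the mandated summit/sub-problem namespace (single-conjunct summit), hence:
set_option linter.dupNamespace false

attribute [local instance] MvPolynomial.gradedAlgebra

namespace Summit.Schanuel.Schanuel.Cruxes.ApproximationProperty.OrbitInterpolationDeterminant

open Summit.Schanuel.Schanuel.Theses.DiophantineDichotomy (ApproximationProperty ApproximationPropertyDegOne)
open Literature.NumberTheory.Transcendental.Nesterenko MvPolynomial
open scoped BigOperators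

/-! ## The crux, pointwise -/

/-- The approximation DATUM of the crux, literally its matrix: `γ` approximates `θ` at scale `(Δ, Y)`
with certified joint degree `d`, naive height `H`, dimension exponent `t`, constant `c`. -/
def APDatum {ι : Type} [Fintype ι] (θ : ι → ℂ) (t : ℕ) (c Δ Y : ℝ) (γ : ι → ℂ) (d H : ℕ) :
    Prop :=
  Module.finrank ℚ ↥(IntermediateField.adjoin ℚ (Set.range γ)) ≤ d ∧
  (∀ i, ∃ P : Polynomial ℤ, P ≠ 0 ∧ P.natDegree ≤ d ∧ (∀ k, |P.coeff k| ≤ (H : ℤ)) ∧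
    Polynomial.aeval (γ i) P = 0) ∧
  (d : ℝ) ≤ (c * Δ) ^ t ∧ Real.log H ≤ c * Y * Δ ^ (t - 1) ∧
  ‖γ - θ‖ ≤ Real.exp (-((Real.log H * Δ + d * Y) / c))

/-- The approximation property AT `θ`, exponent `t`, with a GIVEN constant `c`. -/
def APWith {ι : Type} [Fintype ι] (θ : ι → ℂ) (t : ℕ) (c : ℝ) : Prop :=
  ∀ Δ Y : ℝ, c ≤ Δ → Δ ≤ Y → ∃ (γ : ι → ℂ) (d H : ℕ), APDatum θ t c Δ Y γ d H

/-- The approximation property AT `θ` with exponent `t` (some constant `c ≥ 1`). -/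
def APAt {ι : Type} [Fintype ι] (θ : ι → ℂ) (t : ℕ) : Prop :=
  ∃ c : ℝ, 1 ≤ c ∧ APWith θ t c

/-- The crux, factored pointwise: "`1 ≤ t` and `trdeg_ℚ ℚ(θ) ≤ t` imply `APAt θ t`". -/
def PointwiseAP : Prop :=
  ∀ (ι : Type) [Fintype ι] (θ : ι → ℂ) (t : ℕ), 1 ≤ t →
    Algebra.trdeg ℚ ↥(IntermediateField.adjoin ℚ (Set.range θ)) ≤ (t : Cardinal) → APAt θ t

/-- `PointwiseAP` is the crux, verbatim. -/
theorem pointwiseAP_iff : PointwiseAP ↔ ApproximationProperty := Iff.rfl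

/-- The crux at a FIXED exponent `t` (all finite `ι`, all `θ` with `trdeg ℚ(θ) ≤ t`);
`PointwiseAPSlice 1` is the route's support item `ApproximationPropertyDegOne` up to `(cΔ)^1 = cΔ`. -/
def PointwiseAPSlice (t : ℕ) : Prop :=
  ∀ (ι : Type) [Fintype ι] (θ : ι → ℂ),
    Algebra.trdeg ℚ ↥(IntermediateField.adjoin ℚ (Set.range θ)) ≤ (t : Cardinal) → APAt θ t

/-- The crux is the conjunction of its slices over `t ≥ 1` (pure logic). -/
theorem pointwiseAP_iff_slice : PointwiseAP ↔ ∀ t : ℕ, 1 ≤ t → PointwiseAPSlice t :=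
  ⟨fun h t ht ι _ θ hθ => h ι θ t ht hθ, fun h ι _ θ t ht hθ => h t ht ι θ hθ⟩

/-! ## Input: the 0-cycle approximation property WITH interpolation control (Philippon's AP1, `d' = 0`,
LNM 1752 Ch. 4 §4 p. 61, in Nesterenko's language, plus the interpolation datum) -/

/-- **`CycleAPIAt t`**: for every `ω ∈ ℂᵗ` there is `c ≥ 1` such that for all `Y ≥ Δ ≥ c` some
homogeneous unmixed ideal `I ⊂ ℚ[x₀, …, x_t]` of rank `1` (a 0-dimensional `ℚ`-cycle of `ℙᵗ`) has
`deg I ≤ (cΔ)ᵗ`, `h(I) ≤ c Y Δᵗ⁻¹`, `|I(1 : ω)| ≤ exp(−(Δ·h(I) + Y·deg I)/c)`, and every associated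
prime `𝔭` of `I` satisfies `H_𝔭(⌊cΔ⌋) = deg 𝔭` (its zeros impose independent conditions on the forms of
degree `⌊cΔ⌋`). -/
def CycleAPIAt (t : ℕ) : Prop :=
  ∀ ω : Fin t → ℂ, ∃ c : ℝ, 1 ≤ c ∧ ∀ Δ Y : ℝ, c ≤ Δ → Δ ≤ Y →
    ∃ I : Ideal (Rx t), I.IsHomogeneous (homogeneousSubmodule (Fin (t + 1)) ℚ) ∧
      IsUnmixedOfRank I 1 ∧
      (ideg I 1 : ℝ) ≤ (c * Δ) ^ t ∧
      iheight I 1 ≤ c * Y * Δ ^ (t - 1) ∧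
      iabs I 1 (Fin.cons 1 ω) ≤ Real.exp (-((Δ * iheight I 1 + Y * ideg I 1) / c)) ∧
      ∀ 𝔭 ∈ I.associatedPrimes,
        Module.finrank ℚ ↥(homogeneousSubmodule (Fin (t + 1)) ℚ ⌊c * Δ⌋₊) =
          Module.finrank ℚ ↥(homogeneousSubmodule (Fin (t + 1)) ℚ ⌊c * Δ⌋₊ ⊓ 𝔭.restrictScalars ℚ) +
            ideg 𝔭 1

/-- The input of the line for all dimensions `t ≥ 1`. -/
def CycleAPI : Prop :=
  ∀ t : ℕ, 1 ≤ t → CycleAPIAt t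

/-! ## The lever: the Galois-orbit interpolation determinant -/

/-- **`OrbitClusterBound`** — conjugate clustering costs `k^{1+1/t}`, paid in the INTERPOLATION degree:
for `t ≥ 1` there are `c₀, C > 0` such that for a number field `K`, `β ∈ Kᵗ` whose monomials of total
degree `≤ δ` span `K` over `ℚ`, and `k` distinct complex embeddings putting `σᵢ(β)` in the sup-ball of
radius `r ≤ 1` about `x ∈ ℂᵗ`:
`(c₀ k^{1+1/t} − k) · log(1/r) ≤ C · (δ · h_K(1 : β) + D log(D+1) + k δ log(2 + ‖x‖) + k log(δ+2))`,
`D = [K : ℚ]`, `h_K` = Mathlib's `Height.logHeight` relative to `K`. -/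
def OrbitClusterBound : Prop :=
  ∀ t : ℕ, 1 ≤ t → ∃ c₀ : ℝ, 0 < c₀ ∧ ∃ C : ℝ, 0 < C ∧
    ∀ (K : Type) [Field K] [NumberField K] (β : Fin t → K) (δ k : ℕ) (σ : Fin k → (K →+* ℂ))
      (x : Fin t → ℂ) (r : ℝ),
      (∀ z : K, ∃ Q : MvPolynomial (Fin t) ℚ, Q.totalDegree ≤ δ ∧ MvPolynomial.aeval β Q = z) →
      Function.Injective σ → 0 < r → r ≤ 1 →
      (∀ i, ‖(fun j => σ i (β j)) - x‖ ≤ r) →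
      (c₀ * (k : ℝ) ^ (1 + 1 / (t : ℝ)) - k) * Real.log (1 / r) ≤
        C * (δ * Height.logHeight (Fin.cons (1 : K) β : Fin (t + 1) → K) +
          Module.finrank ℚ K * Real.log (Module.finrank ℚ K + 1) +
          k * δ * Real.log (2 + ‖x‖) + k * Real.log ((δ : ℝ) + 2))

/-! ## The transfer `C⁺`: a sharp closest-point property for 0-dimensional primes -/

/-- **`SharpClosestPoint`**: for every `m ≥ 1` there are `C > 0` (independent of `ℓ`) and `ℓ₀`, and for
every `ℓ ≥ ℓ₀` a constant `C' > 0`, such that for a homogeneous prime `𝔭 ⊂ ℚ[x₀, …, x_m]` of rank `1`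
whose zeros impose independent conditions on the forms of degree `δ` (`H_𝔭(δ) = deg 𝔭`) and an affine
point `(1 : ω)`, some zero `β` of `𝔭` satisfies
`‖(1:ω) − β‖^ℓ ≤ |𝔭(1:ω)| · exp(C δ h(𝔭)/ℓ^{1/m} + C' deg 𝔭 ((δ+1)(log(2+‖ω‖) + 1) + log(deg 𝔭 + 1)))`
(compare the average form, LNM 1752 Ch. 3 Prop. 4.13 at `r = 1`). -/
def SharpClosestPoint : Prop :=
  ∀ m : ℕ, 1 ≤ m → ∃ C : ℝ, 0 < C ∧ ∃ ℓ₀ : ℕ, ∀ ℓ : ℕ, ℓ₀ ≤ ℓ → ∃ C' : ℝ, 0 < C' ∧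
    ∀ (𝔭 : Ideal (Rx m)) (δ : ℕ) (ω : Fin m → ℂ), 𝔭.IsPrime →
      𝔭.IsHomogeneous (homogeneousSubmodule (Fin (m + 1)) ℚ) → IsUnmixedOfRank 𝔭 1 →
      Module.finrank ℚ ↥(homogeneousSubmodule (Fin (m + 1)) ℚ δ) =
        Module.finrank ℚ ↥(homogeneousSubmodule (Fin (m + 1)) ℚ δ ⊓ 𝔭.restrictScalars ℚ) +
          ideg 𝔭 1 →
      ∃ β ∈ projZeros 𝔭,
        projDist (Fin.cons 1 ω) β ^ ℓ ≤
          iabs 𝔭 1 (Fin.cons 1 ω) *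
            Real.exp (C * δ * iheight 𝔭 1 / (ℓ : ℝ) ^ (1 / (m : ℝ)) +
              C' * ideg 𝔭 1 *
                ((δ + 1) * (Real.log (2 + ‖ω‖) + 1) + Real.log ((ideg 𝔭 1 : ℝ) + 1)))

/-! ## The 0-dimensional dictionary (structure of a rank-1 homogeneous prime) -/

/-- **`ZeroDimDictionary`** — the structure of a homogeneous PRIME `𝔭 ⊂ ℚ[x₀, …, x_m]` of rank `1`
(a Galois orbit of points of `ℙᵐ`) in Nesterenko's language, with one constant `c = c(m)`: there are a
number field `K` and `b ∈ K^{m+1} ∖ 0` (`K = ℚ(b)` the field of the point, `b` any representative)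
such that (A) the projective zeros of `𝔭` are exactly the non-zero multiples of the conjugates
`σ ∘ b`, `σ : K →+* ℂ`; (B′) distinct embeddings give distinct projective points; (B)
`[K : ℚ] = deg 𝔭`; (C) `h_K(b) ≤ h(𝔭) + c·deg 𝔭` (Weil height of the point vs height of the Chow form
`F = a ∏_σ ⟨σb, u⟩`: Gauss's lemma at finite places, Gelfond–Mahler at the archimedean one — tree
`Roy2013.sum_mul_logHeight_le'`, `NguyenRoy.logHeight_comp_div_finrank`); (D)
`|𝔭(ω̄)| ≥ e^{−c deg 𝔭} ∏_σ ‖ω̄ − σb‖` (`ϰ(F) = a ∏_σ M_σ(s)` with `|M_σ| = ‖ω̄ − σb‖·|ω̄|·|σb|`,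
Gelfond's lower bound for the product — tree `sum_log_maxNorm_le` — and `|F| ≤ (m+1)^{deg} |a| ∏|σb|`);
(E) in the chart `b₀ ≠ 0`: if the zeros of `𝔭` impose independent conditions on the forms of degree
`δ` (`H_𝔭(δ) = deg 𝔭`) then the monomials of degree `≤ δ` in the affine coordinates `bⱼ/b₀` span `K`
over `ℚ` (evaluation `ℚ[x]_δ → K` has kernel `𝔭_δ` because `𝔭` is the cone ideal of its point, tree
`PhilipponMain.eq_coneIdeal_of_rank_one`). Sources: LNM 1752 Ch. 3 §4 (Prop. 4.4, property 3 of
`|I(ω̄)|`), Ch. 7 §4.3; Philippon 1986 §1. -/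
def ZeroDimDictionary : Prop :=
  ∀ m : ℕ, 1 ≤ m → ∃ c : ℝ, 0 < c ∧
    ∀ 𝔭 : Ideal (Rx m), 𝔭.IsPrime → 𝔭.IsHomogeneous (homogeneousSubmodule (Fin (m + 1)) ℚ) →
      IsUnmixedOfRank 𝔭 1 →
      ∃ (K : Type) (_ : Field K) (_ : NumberField K) (b : Fin (m + 1) → K), b ≠ 0 ∧
        (∀ β : Fin (m + 1) → ℂ, β ∈ projZeros 𝔭 ↔
          β ≠ 0 ∧ ∃ (σ : K →+* ℂ) (l : ℂ), β = fun j => l * σ (b j)) ∧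
        (∀ (σ τ : K →+* ℂ) (l : ℂ), (fun j => σ (b j)) = (fun j => l * τ (b j)) → σ = τ) ∧
        Module.finrank ℚ K = ideg 𝔭 1 ∧
        Height.logHeight b ≤ iheight 𝔭 1 + c * ideg 𝔭 1 ∧
        (∀ ω : Fin (m + 1) → ℂ, ω ≠ 0 →
          Real.exp (-(c * ideg 𝔭 1)) * ∏ σ : K →+* ℂ, projDist ω (fun j => σ (b j)) ≤
            iabs 𝔭 1 ω) ∧
        (b 0 ≠ 0 → ∀ δ : ℕ,
          Module.finrank ℚ ↥(homogeneousSubmodule (Fin (m + 1)) ℚ δ) =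
            Module.finrank ℚ ↥(homogeneousSubmodule (Fin (m + 1)) ℚ δ ⊓ 𝔭.restrictScalars ℚ) +
              ideg 𝔭 1 →
          ∀ z : K, ∃ Q : MvPolynomial (Fin m) ℚ, Q.totalDegree ≤ δ ∧
            MvPolynomial.aeval (fun j : Fin m => b j.succ / b 0) Q = z)

/-! ## Output before lifting: the point approximation property in the Weil currency -/

/-- **`PointAPAbsAt t`** — AP2 at the affine points of `ℂᵗ` in the projective/Weil currency
`([K:ℚ], h_K(1:β))`: for every `ω ∈ ℂᵗ` there is `c ≥ 1` such that for all `Y ≥ Δ ≥ c` there are a number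
field `K`, `β ∈ Kᵗ` and an embedding `σ : K →+* ℂ` with `[K:ℚ] ≤ (cΔ)ᵗ`, `h_K(1 : β) ≤ c Y Δᵗ⁻¹` and
`‖σ(β) − ω‖_∞ ≤ exp(−(Δ · h_K(1:β) + Y · [K:ℚ])/c)`. -/
def PointAPAbsAt (t : ℕ) : Prop :=
  ∀ ω : Fin t → ℂ, ∃ c : ℝ, 1 ≤ c ∧ ∀ Δ Y : ℝ, c ≤ Δ → Δ ≤ Y →
    ∃ (K : Type) (_ : Field K) (_ : NumberField K) (β : Fin t → K) (σ : K →+* ℂ),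
      (Module.finrank ℚ K : ℝ) ≤ (c * Δ) ^ t ∧
      Height.logHeight (Fin.cons (1 : K) β : Fin (t + 1) → K) ≤ c * Y * Δ ^ (t - 1) ∧
      ‖(fun j => σ (β j)) - ω‖ ≤
        Real.exp (-((Δ * Height.logHeight (Fin.cons (1 : K) β : Fin (t + 1) → K) +
          Y * Module.finrank ℚ K) / c))

/-- The point property in the Weil currency in every dimension `t ≥ 1`. -/
def PointAPAbs : Prop :=
  ∀ t : ℕ, 1 ≤ t → PointAPAbsAt t

/-! ## Sanity: the `t = 1` slice is the route's support item (pure bookkeeping) -/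

/-- `PointwiseAPSlice 1` gives `ApproximationPropertyDegOne` (stmt-Schanuel-11037):
`(cΔ)^1 = cΔ`, `Δ^(1-1) = 1`. -/
theorem degOne_of_slice_one : PointwiseAPSlice 1 → ApproximationPropertyDegOne := by
  intro h ι _ θ hθ
  obtain ⟨c, hc, hall⟩ := h ι θ (by simpa using hθ)
  refine ⟨c, hc, fun Δ Y hΔ hY => ?_⟩
  obtain ⟨γ, d, H, h1, h2, h3, h4, h5⟩ := hall Δ Y hΔ hY
  exact ⟨γ, d, H, h1, h2, by simpa using h3, by simpa using h4, h5⟩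

end Summit.Schanuel.Schanuel.Cruxes.ApproximationProperty.OrbitInterpolationDeterminant

end
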